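import Summits.ValiantsHypothesis.ValiantsHypothesis.Theorems.LacunarySymmetroidMatrixDescartesFiniteSectorStampCeilingEightSixA
import Summits.ValiantsHypothesis.ValiantsHypothesis.Theorems.LacunarySymmetroidMatrixDescartesFiniteSectorStampCeilingEightSixB
import Summits.ValiantsHypothesis.ValiantsHypothesis.Theorems.LacunarySymmetroidMatrixDescartesFiniteSectorStampCeilingEightSixC
import Summits.ValiantsHypothesis.ValiantsHypothesis.Theorems.LacunarySymmetroidMatrixDescartesFiniteSectorStampCeilingEightSixD
import Summits.ValiantsHypothesis.ValiantsHypothesis.Theorems.LacunarySymmetroidMatrixDescartesFiniteSectorStampCeilingEightSixE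
import Summits.ValiantsHypothesis.ValiantsHypothesis.Theorems.LacunarySymmetroidMatrixDescartesFiniteSectorStampCeilingEightSixF
import Summits.ValiantsHypothesis.ValiantsHypothesis.Theorems.LacunarySymmetroidMatrixDescartesFiniteSectorStampCeilingEightSixG
import Summits.ValiantsHypothesis.ValiantsHypothesis.Theorems.LacunarySymmetroidMatrixDescartesFiniteSectorStampCeilingEightSixH
import Summits.ValiantsHypothesis.ValiantsHypothesis.Theorems.LacunarySymmetroidMatrixDescartesFiniteSectorStampCeilingEightSixI
import Summits.ValiantsHypothesis.ValiantsHypothesis.Theorems.LacunarySymmetroidMatrixDescartesFiniteSectorStampCeilingEightSixJ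
import Summits.ValiantsHypothesis.ValiantsHypothesis.Theorems.LacunarySymmetroidMatrixDescartesFiniteSectorStampCeilingEightSixK
import Summits.ValiantsHypothesis.ValiantsHypothesis.Theorems.LacunarySymmetroidMatrixDescartesFiniteSectorStampCeilingEightSixL
import Summits.ValiantsHypothesis.ValiantsHypothesis.Theorems.LacunarySymmetroidMatrixDescartesFiniteSectorStampCeilingEightSixM
import Summits.ValiantsHypothesis.ValiantsHypothesis.Theorems.LacunarySymmetroidMatrixDescartesFiniteSectorStampCeilingEightSixN
import Summits.ValiantsHypothesis.ValiantsHypothesis.Theorems.LacunarySymmetroidMatrixDescartesFiniteSectorStampCeilingEightSixO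
import Summits.ValiantsHypothesis.ValiantsHypothesis.Theorems.LacunarySymmetroidMatrixDescartesFiniteSectorStampCeilingEightSixP
import Summits.ValiantsHypothesis.ValiantsHypothesis.Theorems.LacunarySymmetroidMatrixDescartesFiniteSectorStampCeilingEightSixQ
import Summits.ValiantsHypothesis.ValiantsHypothesis.Theorems.LacunarySymmetroidMatrixDescartesFiniteSectorStampCeilingEightSixR
import Summits.ValiantsHypothesis.ValiantsHypothesis.Theorems.LacunarySymmetroidMatrixDescartesFiniteSectorStampCeilingEightSixS
import Summits.ValiantsHypothesis.ValiantsHypothesis.Theorems.LacunarySymmetroidMatrixDescartesFiniteSectorStampCeilingEightSixT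
import Summits.ValiantsHypothesis.ValiantsHypothesis.Theorems.LacunarySymmetroidMatrixDescartesFiniteSectorSumMasksHigherThree
import Summits.ValiantsHypothesis.ValiantsHypothesis.Theorems.LacunarySymmetroidMatrixDescartesFiniteSectorSectorCeilingMTwoKNineO

/-!
# `MatrixDescartes` — line «stamp»: the STAMP CEILING `ν(8,6) ≤ 512 = n(8,5)` (kernel) — `StampLawAt 8 6 512`

HONEST FRAMING.  Object-search cell `pub-symmetroid`, seat val-sym-door-p5 g10 (generators of val-sym-door-p5 g8/g9 VERBATIM, m-tables extended to m ≤ 19; fold binders typed `(x acc : ℕ)` — same elaborated terms, fast elaboration).  HELPER of the crux item `stmt-ValiantsHypothesis-18050` with NO closure claim.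
T3 (`mem_sumset_of_fullPos`) makes every `r ≤ deg` of a full-positive-rooted symmetric `8 × 8` half-pencil with `6` terms an `8`-fold sum of exponents; the
values `0, 1` occur, and the capped, padded, sorted value set must cover `[0, deg]`; the finite core — no `5` denominations with `8` stamps cover `[0, 513]`
(`n(8,5) = 512`) — has 581715 live prefixes and is decided in the kernel in SLICES by the third and fourth values `(a,b)` (`a ≤ 9`, `b ≤ 8a + 1` forced by
the cover at `9` and `8a + 1`; dead pairs in that range are refuted by `decide` on the prefix atom): slices in
`…FiniteSectorStampCeilingEightSixA`, `…FiniteSectorStampCeilingEightSixB`, `…FiniteSectorStampCeilingEightSixC`, `…FiniteSectorStampCeilingEightSixD`, `…FiniteSectorStampCeilingEightSixE`, `…FiniteSectorStampCeilingEightSixF`, `…FiniteSectorStampCeilingEightSixG`, `…FiniteSectorStampCeilingEightSixH`, `…FiniteSectorStampCeilingEightSixI`, `…FiniteSectorStampCeilingEightSixJ`, `…FiniteSectorStampCeilingEightSixK`, `…FiniteSectorStampCeilingEightSixL`, `…FiniteSectorStampCeilingEightSixM`, `…FiniteSectorStampCeilingEightSixN`, `…FiniteSectorStampCeilingEightSixO`,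 `…FiniteSectorStampCeilingEightSixP`, `…FiniteSectorStampCeilingEightSixQ`, `…FiniteSectorStampCeilingEightSixR`, `…FiniteSectorStampCeilingEightSixS`, `…FiniteSectorStampCeilingEightSixT` (this file holds the transfer only); `8`-fold sums as
iterated shift-form bitmasks.  Result: `stampLawAt_eight_six : StampLawAt 8 6 512`.  Located first (exact DFS, this seat): best reach of `5` denominations with `8`
stamps = `512` (e.g. {1,9,15,78,115}).  Nothing here bears on the crux (asymptotic), on the doors, or on `VP ≠ VNP`.
[folklore] Postage-stamp bookkeeping on the proved T3 (Guy UPINT C12; Challis / Mossige tables); no citation is load-bearing.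
-/

-- `Summit.ValiantsHypothesis.ValiantsHypothesis.…` repeats a component by the D-0017 layout
-- (single-conjunct summit), which the `dupNamespace` linter flags; the name is mandated.
set_option linter.dupNamespace false

namespace Summit.ValiantsHypothesis.ValiantsHypothesis.Theorems.LacunarySymmetroidMatrixDescartes.FiniteSector

open scoped BigOperators Matrix
open Polynomial

/-! ## `(8,6)`: `ν(8,6) ≤ n(8,5) = 512` — the transfer -/

set_option maxHeartbeats 4000000 in
/-- **`ν(8,6) ≤ 512 = n(8,5)`** — `StampLawAt 8 6 512`: every full-positive-rooted symmetric `8 × 8` half-pencil determinant with `6` terms has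
degree `≤ 512` (T3 ⇒ every `r ≤ deg` is an `8`-fold sum; values `0, 1` forced; capped at `514`, padded, sorted; `a ≤ 9`, `b ≤ 8a + 1`; bitmasks; the slice checks). [folklore] -/
theorem stampLawAt_eight_six : StampLawAt 8 6 512 := by
  intro d S hS hfull
  by_contra hdeg'
  have hdeg : 512 < (pencil d S).det.natDegree := not_le.mp hdeg'
  have hq : (pencil d S).det ≠ 0 := by
    intro h0
    rw [h0] at hdeg
    simp at hdeg
  have hmem : ∀ r, r ≤ (pencil d S).det.natDegree → ∃ i j k l n o q i₁ : Fin 6, d i + d j + d k + d l + d n + d o + d q + d i₁ = r := by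
    intro r hr
    have hm := mem_sumset_of_fullPos d S hq hfull hr
    rw [Finset.mem_image] at hm
    obtain ⟨s, -, hs⟩ := hm
    obtain ⟨i, j, k, l, n, o, q, i₁, h8⟩ := exists_sum_eq_of_card_eight d (s : Multiset (Fin 6)) s.2
    exact ⟨i, j, k, l, n, o, q, i₁, by omega⟩
  set cv : Fin 6 → ℕ := fun i => min (d i) 514 with hcv
  have hcvd : ∀ i, d i ≤ 513 → cv i = d i := fun i hi => by
    simp only [hcv]
    exact Nat.min_eq_left (by omega)
  have hcvle : ∀ i, cv i ≤ 514 := fun i => Nat.min_le_right _ _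
  set V : Finset ℕ := Finset.univ.image cv with hV
  have hcvV : ∀ i, cv i ∈ V := fun i => Finset.mem_image_of_mem cv (Finset.mem_univ i)
  have h0V : 0 ∈ V := by
    obtain ⟨i, j, k, l, n, o, q, i₁, hh⟩ := hmem 0 (Nat.zero_le _)
    have : cv i = 0 := by rw [hcvd i (by omega)]; omega
    exact this ▸ hcvV i
  have h1V : 1 ∈ V := by
    obtain ⟨i, j, k, l, n, o, q, i₁, hh⟩ := hmem 1 (by omega)
    have key : ∃ t : Fin 6, d t = 1 := by
      by_contra hne; simp only [not_exists] at hne; have hz0 : d i = 0 := (by have := hne i; omega); have hz1 : d j = 0 := (by have := hne j; omega); have hz2 : d k = 0 := (by have := hne k; omega); have hz3 : d l = 0 := (by have := hne l; omega); have hz4 : d n = 0 := (by have := hne n; omega); have hz5 : d o = 0 := (by have := hne o; omega); have hz6 : d q = 0 := (by have := hne q; omega); have hz7 : d i₁ = 0 := (by have := hne i₁; omega); omega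
    obtain ⟨t, ht⟩ := key
    have : cv t = 1 := by rw [hcvd t (by omega)]; omega
    exact this ▸ hcvV t
  have h1V' : 1 ∈ V.erase 0 := Finset.mem_erase.mpr ⟨by norm_num, h1V⟩
  set W : Finset ℕ := (V.erase 0).erase 1 with hW
  have hWsub : W ⊆ ((Finset.range 515).erase 0).erase 1 := by
    intro u hu
    rw [hW, Finset.mem_erase, Finset.mem_erase] at hu
    obtain ⟨hu1, hu0, huV⟩ := hu
    rw [hV, Finset.mem_image] at huV
    obtain ⟨i, -, rfl⟩ := huV
    rw [Finset.mem_erase, Finset.mem_erase, Finset.mem_range]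
    exact ⟨hu1, hu0, Nat.lt_succ_of_le (hcvle i)⟩
  have hWcard : W.card ≤ 4 := by
    have hVK : V.card ≤ 6 := by
      have := Finset.card_image_le (s := (Finset.univ : Finset (Fin 6))) (f := cv)
      simpa using this
    have h1 : (V.erase 0).card + 1 = V.card := Finset.card_erase_add_one h0V
    have h2 : W.card + 1 = (V.erase 0).card := by rw [hW]; exact Finset.card_erase_add_one h1V'
    omega
  obtain ⟨W', hWW', hW'sub, hW'card⟩ := Finset.exists_subsuperset_card_eq hWsub hWcard (by
    rw [Finset.card_erase_of_mem (by simp), Finset.card_erase_of_mem (by simp), Finset.card_range]; omega)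
  have hVW' : ∀ u ∈ V, u = 0 ∨ u = 1 ∨ u ∈ W' := by
    intro u hu
    by_cases hu0 : u = 0
    · exact Or.inl hu0
    by_cases hu1 : u = 1
    · exact Or.inr (Or.inl hu1)
    · exact Or.inr (Or.inr (hWW' (by rw [hW, Finset.mem_erase, Finset.mem_erase]; exact ⟨hu1, hu0, hu⟩)))
  have hlmem : ∀ u, u ∈ Finset.sort W' ↔ u ∈ W' := fun u => Finset.mem_sort _
  have hlsort : (Finset.sort W').SortedLT := Finset.sortedLT_sort W'
  have hllen : (Finset.sort W').length = 4 := by rw [Finset.length_sort, hW'card]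
  generalize hl : Finset.sort W' = l at hlmem hlsort hllen
  rcases l with _ | ⟨a, _ | ⟨b, _ | ⟨c, _ | ⟨e, _ | ⟨zz, ll⟩⟩⟩⟩⟩
  all_goals simp only [List.length_cons, List.length_nil] at hllen
  all_goals try omega
  have hmemR : ∀ u, u ∈ [a, b, c, e] → u ∈ List.range 515 := by
    intro u hu
    have hu' : u ∈ W' := (hlmem u).mp hu
    have := hW'sub hu'
    rw [Finset.mem_erase, Finset.mem_erase, Finset.mem_range] at this
    exact List.mem_range.mpr this.2.2
  have hgt1 : ∀ u, u ∈ [a, b, c, e] → 1 < u := by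
    intro u hu
    have hu' : u ∈ W' := (hlmem u).mp hu
    have := hW'sub hu'
    rw [Finset.mem_erase, Finset.mem_erase] at this
    omega
  have h1a : 1 < a := hgt1 a (by simp)
  have hmemP : ∀ r, r ≤ 513 → (∃ i j k l n o q i₁ : Fin 6, d i + d j + d k + d l + d n + d o + d q + d i₁ = r) → (∃ x ∈ [0, 1, a, b, c, e], ∃ y ∈ [0, 1, a, b, c, e], ∃ z ∈ [0, 1, a, b, c, e], ∃ w ∈ [0, 1, a, b, c, e], ∃ v ∈ [0, 1, a, b, c, e], ∃ o ∈ [0, 1, a, b, c, e], ∃ t ∈ [0, 1, a, b, c, e], ∃ e₁ ∈ [0, 1, a, b, c, e], x + y + z + w + v + o + t + e₁ = r) := by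
    rintro r hr ⟨i, j, k, l, n, o, q, i₁, hsum⟩
    have hi : cv i = d i := hcvd i (by omega)
    have hj : cv j = d j := hcvd j (by omega)
    have hk : cv k = d k := hcvd k (by omega)
    have hl : cv l = d l := hcvd l (by omega)
    have hn : cv n = d n := hcvd n (by omega)
    have ho : cv o = d o := hcvd o (by omega)
    have hq : cv q = d q := hcvd q (by omega)
    have hi₁ : cv i₁ = d i₁ := hcvd i₁ (by omega)
    have hin : ∀ u ∈ V, u ∈ [0, 1, a, b, c, e] := by
      intro u hu
      rcases hVW' u hu with h | h | h
      · rw [h]; simp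
      · rw [h]; simp
      · exact List.mem_cons_of_mem _ (List.mem_cons_of_mem _ ((hlmem u).mpr h))
    exact ⟨cv i, hin _ (hcvV i), cv j, hin _ (hcvV j), cv k, hin _ (hcvV k), cv l, hin _ (hcvV l), cv n, hin _ (hcvV n), cv o, hin _ (hcvV o), cv q, hin _ (hcvV q), cv i₁, hin _ (hcvV i₁), by rw [hi, hj, hk, hl, hn, ho, hq, hi₁]; exact hsum⟩
  have hcovP : ∀ r, r ≤ 513 → (∃ x ∈ [0, 1, a, b, c, e], ∃ y ∈ [0, 1, a, b, c, e], ∃ z ∈ [0, 1, a, b, c, e], ∃ w ∈ [0, 1, a, b, c, e], ∃ v ∈ [0, 1, a, b, c, e], ∃ o ∈ [0, 1, a, b, c, e], ∃ t ∈ [0, 1, a, b, c, e], ∃ e₁ ∈ [0, 1, a, b, c, e], x + y + z + w + v + o + t + e₁ = r) := fun r hr => hmemP r hr (hmem r (by omega))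
  have hlt1 : a < b := by
    have := hlsort (show (⟨0, by simp⟩ : Fin [a, b, c, e].length) < ⟨1, by simp⟩ from Fin.mk_lt_mk.mpr (by norm_num))
    simpa using this
  have hlt2 : b < c := by
    have := hlsort (show (⟨1, by simp⟩ : Fin [a, b, c, e].length) < ⟨2, by simp⟩ from Fin.mk_lt_mk.mpr (by norm_num))
    simpa using this
  have hlt3 : c < e := by
    have := hlsort (show (⟨2, by simp⟩ : Fin [a, b, c, e].length) < ⟨3, by simp⟩ from Fin.mk_lt_mk.mpr (by norm_num))
    simpa using this
  -- bound on the third value: `a ≤ 9` (cover at `9`); the fourth value is bounded per `a` below (first missing bit of the explicit mask of `[0, 1, a]`)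
  have hrestA : ∀ y ∈ [a, b, c, e], a ≤ y := by
    intro y hy
    simp only [List.mem_cons, List.mem_nil_iff, or_false] at hy
    omega
  have haM : a ≤ 9 := by
    by_contra hh
    obtain ⟨x, hx, y, hy, z, hz, w, hw, v, hv, o, ho, t, ht, e₁, he₁, hsum⟩ := memP8_prefix (l₁ := [0, 1]) (l₂ := [a, b, c, e]) hrestA (show 9 < a by omega) (hcovP 9 (by omega))
    simp only [List.mem_cons, List.mem_nil_iff, or_false] at hx hy hz hw hv ho ht he₁
    (have hx' : x ≤ 1 := by rcases hx with hh0 | hh0 <;> omega); (have hy' : y ≤ 1 := by rcases hy with hh0 | hh0 <;> omega); (have hz' : z ≤ 1 := by rcases hz with hh0 | hh0 <;> omega); (have hw' : w ≤ 1 := by rcases hw with hh0 | hh0 <;> omega)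
    (have hv' : v ≤ 1 := by rcases hv with hh0 | hh0 <;> omega); (have ho' : o ≤ 1 := by rcases ho with hh0 | hh0 <;> omega); (have ht' : t ≤ 1 := by rcases ht with hh0 | hh0 <;> omega); (have he₁' : e₁ ≤ 1 := by rcases he₁ with hh0 | hh0 <;> omega)
    clear hx hy hz hw hv ho ht he₁; omega
  have pre2 : (List.foldr (fun (x acc : ℕ) => acc ||| (List.foldr (fun (x acc : ℕ) => acc ||| (List.foldr (fun (x acc : ℕ) => acc ||| (List.foldr (fun (x acc : ℕ) => acc ||| (List.foldr (fun (x acc : ℕ) => acc ||| (List.foldr (fun (x acc : ℕ) => acc ||| (List.foldr (fun (x acc : ℕ) => acc ||| (List.foldr (fun (y acc : ℕ) => acc ||| 2 ^ y) 0 [0, 1, a]) * 2 ^ x) 0 [0, 1, a]) * 2 ^ x) 0 [0, 1, a]) * 2 ^ x) 0 [0, 1, a]) * 2 ^ x) 0 [0, 1, a]) * 2 ^ x) 0 [0, 1, a]) * 2 ^ x) 0 [0, 1, a]) * 2 ^ x) 0 [0, 1, a] % 2 ^ (min 514 b) = 2 ^ (min 514 b) - 1) := by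
    apply maskFull_of_testBit
    intro r hr
    have hrN : r < 514 := lt_of_lt_of_le hr (min_le_left _ _)
    have hrv : r < b := lt_of_lt_of_le hr (min_le_right _ _)
    have hrest : ∀ y ∈ [b, c, e], b ≤ y := by
      intro y hy
      simp only [List.mem_cons, List.mem_nil_iff, or_false] at hy
      omega
    exact testBit_fold8Shift_of_mem (memP8_prefix (l₁ := [0, 1, a]) (l₂ := [b, c, e]) hrest hrv (hcovP r (by omega)))
  have pre3 : (List.foldr (fun (x acc : ℕ) => acc ||| (List.foldr (fun (x acc : ℕ) => acc ||| (List.foldr (fun (x acc : ℕ) => acc ||| (List.foldr (fun (x acc : ℕ) => acc ||| (List.foldr (fun (x acc : ℕ) => acc ||| (List.foldr (fun (x acc : ℕ) => acc ||| (List.foldr (fun (x acc : ℕ) => acc ||| (List.foldr (fun (y acc : ℕ) => acc ||| 2 ^ y) 0 [0, 1, a, b]) * 2 ^ x) 0 [0, 1, a, b]) * 2 ^ x) 0 [0, 1, a, b]) * 2 ^ x) 0 [0, 1, a, b]) * 2 ^ x) 0 [0, 1, a, b]) * 2 ^ x) 0 [0, 1, a, b]) * 2 ^ x) 0 [0, 1,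 a, b]) * 2 ^ x) 0 [0, 1, a, b] % 2 ^ (min 514 c) = 2 ^ (min 514 c) - 1) := by
    clear pre2
    apply maskFull_of_testBit
    intro r hr
    have hrN : r < 514 := lt_of_lt_of_le hr (min_le_left _ _)
    have hrv : r < c := lt_of_lt_of_le hr (min_le_right _ _)
    have hrest : ∀ y ∈ [c, e], c ≤ y := by
      intro y hy
      simp only [List.mem_cons, List.mem_nil_iff, or_false] at hy
      omega
    exact testBit_fold8Shift_of_mem (memP8_prefix (l₁ := [0, 1, a, b]) (l₂ := [c, e]) hrest hrv (hcovP r (by omega)))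
  have pre4 : (List.foldr (fun (x acc : ℕ) => acc ||| (List.foldr (fun (x acc : ℕ) => acc ||| (List.foldr (fun (x acc : ℕ) => acc ||| (List.foldr (fun (x acc : ℕ) => acc ||| (List.foldr (fun (x acc : ℕ) => acc ||| (List.foldr (fun (x acc : ℕ) => acc ||| (List.foldr (fun (x acc : ℕ) => acc ||| (List.foldr (fun (y acc : ℕ) => acc ||| 2 ^ y) 0 [0, 1, a, b, c]) * 2 ^ x) 0 [0, 1, a, b, c]) * 2 ^ x) 0 [0, 1, a, b, c]) * 2 ^ x) 0 [0, 1, a, b, c]) * 2 ^ x) 0 [0, 1, a, b, c]) * 2 ^ x) 0 [0, 1, a, b, c]) * 2 ^ x) 0 [0, 1, a, b, c]) * 2 ^ x) 0 [0, 1, a, b, c] % 2 ^ (min 514 e) = 2 ^ (min 514 e) - 1) := by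
    clear pre2 pre3
    apply maskFull_of_testBit
    intro r hr
    have hrN : r < 514 := lt_of_lt_of_le hr (min_le_left _ _)
    have hrv : r < e := lt_of_lt_of_le hr (min_le_right _ _)
    have hrest : ∀ y ∈ [e], e ≤ y := by
      intro y hy
      simp only [List.mem_cons, List.mem_nil_iff, or_false] at hy
      omega
    exact testBit_fold8Shift_of_mem (memP8_prefix (l₁ := [0, 1, a, b, c]) (l₂ := [e]) hrest hrv (hcovP r (by omega)))
  have hcovT : (List.foldr (fun (x acc : ℕ) => acc ||| (List.foldr (fun (x acc : ℕ) => acc ||| (List.foldr (fun (x acc : ℕ) => acc ||| (List.foldr (fun (x acc : ℕ) => acc ||| (List.foldr (fun (x acc : ℕ) => acc ||| (List.foldr (fun (x acc : ℕ) => acc ||| (List.foldr (fun (x acc : ℕ) => acc ||| (List.foldr (fun (y acc : ℕ) => acc ||| 2 ^ y) 0 [0, 1, a, b, c, e]) * 2 ^ x) 0 [0, 1, a, b, c, e]) * 2 ^ x) 0 [0, 1, a, b, c, e]) * 2 ^ x) 0 [0, 1, a, b, c, e]) * 2 ^ x) 0 [0, 1, a, b, c, e]) * 2 ^ x) 0 [0,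 1, a, b, c, e]) * 2 ^ x) 0 [0, 1, a, b, c, e]) * 2 ^ x) 0 [0, 1, a, b, c, e] % 2 ^ 514 = 2 ^ 514 - 1) := by
    clear pre2 pre3 pre4
    exact maskFull_of_testBit (fun r hr => testBit_fold8Shift_of_mem (hcovP r (by omega)))
  interval_cases a
  · -- a = 2: the 8-fold sums of [0, 1, 2] cover [0, 16] and miss 17 ⇒ b ≤ 17
    have hbT : b ≤ 17 := by
      by_contra hh
      exact absurd (testBit_of_maskMod pre2 (show 17 < min 514 b by omega)) (by decide +kernel)
    interval_cases b
    · exact stampCheck_eight_six_s2_3 c (hmemR c (by simp)) ⟨hlt2, pre3⟩ e (hmemR e (by simp)) ⟨hlt3, pre4⟩ hcovT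
    · exact stampCheck_eight_six_s2_4 c (hmemR c (by simp)) ⟨hlt2, pre3⟩ e (hmemR e (by simp)) ⟨hlt3, pre4⟩ hcovT
    · exact stampCheck_eight_six_s2_5 c (hmemR c (by simp)) ⟨hlt2, pre3⟩ e (hmemR e (by simp)) ⟨hlt3, pre4⟩ hcovT
    · exact stampCheck_eight_six_s2_6 c (hmemR c (by simp)) ⟨hlt2, pre3⟩ e (hmemR e (by simp)) ⟨hlt3, pre4⟩ hcovT
    · exact stampCheck_eight_six_s2_7 c (hmemR c (by simp)) ⟨hlt2, pre3⟩ e (hmemR e (by simp)) ⟨hlt3, pre4⟩ hcovT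
    · exact stampCheck_eight_six_s2_8 c (hmemR c (by simp)) ⟨hlt2, pre3⟩ e (hmemR e (by simp)) ⟨hlt3, pre4⟩ hcovT
    · exact stampCheck_eight_six_s2_9 c (hmemR c (by simp)) ⟨hlt2, pre3⟩ e (hmemR e (by simp)) ⟨hlt3, pre4⟩ hcovT
    · exact stampCheck_eight_six_s2_10 c (hmemR c (by simp)) ⟨hlt2, pre3⟩ e (hmemR e (by simp)) ⟨hlt3, pre4⟩ hcovT
    · exact stampCheck_eight_six_s2_11 c (hmemR c (by simp)) ⟨hlt2, pre3⟩ e (hmemR e (by simp)) ⟨hlt3, pre4⟩ hcovT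
    · exact stampCheck_eight_six_s2_12 c (hmemR c (by simp)) ⟨hlt2, pre3⟩ e (hmemR e (by simp)) ⟨hlt3, pre4⟩ hcovT
    · exact stampCheck_eight_six_s2_13 c (hmemR c (by simp)) ⟨hlt2, pre3⟩ e (hmemR e (by simp)) ⟨hlt3, pre4⟩ hcovT
    · exact stampCheck_eight_six_s2_14 c (hmemR c (by simp)) ⟨hlt2, pre3⟩ e (hmemR e (by simp)) ⟨hlt3, pre4⟩ hcovT
    · exact stampCheck_eight_six_s2_15 c (hmemR c (by simp)) ⟨hlt2, pre3⟩ e (hmemR e (by simp)) ⟨hlt3, pre4⟩ hcovT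
    · exact stampCheck_eight_six_s2_16 c (hmemR c (by simp)) ⟨hlt2, pre3⟩ e (hmemR e (by simp)) ⟨hlt3, pre4⟩ hcovT
    · exact stampCheck_eight_six_s2_17 c (hmemR c (by simp)) ⟨hlt2, pre3⟩ e (hmemR e (by simp)) ⟨hlt3, pre4⟩ hcovT
  · -- a = 3: the 8-fold sums of [0, 1, 3] cover [0, 22] and miss 23 ⇒ b ≤ 23
    have hbT : b ≤ 23 := by
      by_contra hh
      exact absurd (testBit_of_maskMod pre2 (show 23 < min 514 b by omega)) (by decide +kernel)
    interval_cases b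
    · exact stampCheck_eight_six_s3_4 c (hmemR c (by simp)) ⟨hlt2, pre3⟩ e (hmemR e (by simp)) ⟨hlt3, pre4⟩ hcovT
    · exact stampCheck_eight_six_s3_5 c (hmemR c (by simp)) ⟨hlt2, pre3⟩ e (hmemR e (by simp)) ⟨hlt3, pre4⟩ hcovT
    · exact stampCheck_eight_six_s3_6 c (hmemR c (by simp)) ⟨hlt2, pre3⟩ e (hmemR e (by simp)) ⟨hlt3, pre4⟩ hcovT
    · exact stampCheck_eight_six_s3_7 c (hmemR c (by simp)) ⟨hlt2, pre3⟩ e (hmemR e (by simp)) ⟨hlt3, pre4⟩ hcovT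
    · exact stampCheck_eight_six_s3_8 c (hmemR c (by simp)) ⟨hlt2, pre3⟩ e (hmemR e (by simp)) ⟨hlt3, pre4⟩ hcovT
    · exact stampCheck_eight_six_s3_9 c (hmemR c (by simp)) ⟨hlt2, pre3⟩ e (hmemR e (by simp)) ⟨hlt3, pre4⟩ hcovT
    · exact stampCheck_eight_six_s3_10 c (hmemR c (by simp)) ⟨hlt2, pre3⟩ e (hmemR e (by simp)) ⟨hlt3, pre4⟩ hcovT
    · exact stampCheck_eight_six_s3_11 c (hmemR c (by simp)) ⟨hlt2, pre3⟩ e (hmemR e (by simp)) ⟨hlt3, pre4⟩ hcovT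
    · exact stampCheck_eight_six_s3_12 c (hmemR c (by simp)) ⟨hlt2, pre3⟩ e (hmemR e (by simp)) ⟨hlt3, pre4⟩ hcovT
    · exact stampCheck_eight_six_s3_13 c (hmemR c (by simp)) ⟨hlt2, pre3⟩ e (hmemR e (by simp)) ⟨hlt3, pre4⟩ hcovT
    · exact stampCheck_eight_six_s3_14 c (hmemR c (by simp)) ⟨hlt2, pre3⟩ e (hmemR e (by simp)) ⟨hlt3, pre4⟩ hcovT
    · exact stampCheck_eight_six_s3_15 c (hmemR c (by simp)) ⟨hlt2, pre3⟩ e (hmemR e (by simp)) ⟨hlt3, pre4⟩ hcovT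
    · exact stampCheck_eight_six_s3_16 c (hmemR c (by simp)) ⟨hlt2, pre3⟩ e (hmemR e (by simp)) ⟨hlt3, pre4⟩ hcovT
    · exact stampCheck_eight_six_s3_17 c (hmemR c (by simp)) ⟨hlt2, pre3⟩ e (hmemR e (by simp)) ⟨hlt3, pre4⟩ hcovT
    · exact stampCheck_eight_six_s3_18 c (hmemR c (by simp)) ⟨hlt2, pre3⟩ e (hmemR e (by simp)) ⟨hlt3, pre4⟩ hcovT
    · exact stampCheck_eight_six_s3_19 c (hmemR c (by simp)) ⟨hlt2, pre3⟩ e (hmemR e (by simp)) ⟨hlt3, pre4⟩ hcovT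
    · exact stampCheck_eight_six_s3_20 c (hmemR c (by simp)) ⟨hlt2, pre3⟩ e (hmemR e (by simp)) ⟨hlt3, pre4⟩ hcovT
    · exact stampCheck_eight_six_s3_21 c (hmemR c (by simp)) ⟨hlt2, pre3⟩ e (hmemR e (by simp)) ⟨hlt3, pre4⟩ hcovT
    · exact stampCheck_eight_six_s3_22 c (hmemR c (by simp)) ⟨hlt2, pre3⟩ e (hmemR e (by simp)) ⟨hlt3, pre4⟩ hcovT
    · exact stampCheck_eight_six_s3_23 c (hmemR c (by simp)) ⟨hlt2, pre3⟩ e (hmemR e (by simp)) ⟨hlt3, pre4⟩ hcovT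
  · -- a = 4: the 8-fold sums of [0, 1, 4] cover [0, 26] and miss 27 ⇒ b ≤ 27
    have hbT : b ≤ 27 := by
      by_contra hh
      exact absurd (testBit_of_maskMod pre2 (show 27 < min 514 b by omega)) (by decide +kernel)
    interval_cases b
    · exact stampCheck_eight_six_s4_5 c (hmemR c (by simp)) ⟨hlt2, pre3⟩ e (hmemR e (by simp)) ⟨hlt3, pre4⟩ hcovT
    · exact stampCheck_eight_six_s4_6 c (hmemR c (by simp)) ⟨hlt2, pre3⟩ e (hmemR e (by simp)) ⟨hlt3, pre4⟩ hcovT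
    · exact stampCheck_eight_six_s4_7 c (hmemR c (by simp)) ⟨hlt2, pre3⟩ e (hmemR e (by simp)) ⟨hlt3, pre4⟩ hcovT
    · exact stampCheck_eight_six_s4_8 c (hmemR c (by simp)) ⟨hlt2, pre3⟩ e (hmemR e (by simp)) ⟨hlt3, pre4⟩ hcovT
    · exact stampCheck_eight_six_s4_9 c (hmemR c (by simp)) ⟨hlt2, pre3⟩ e (hmemR e (by simp)) ⟨hlt3, pre4⟩ hcovT
    · exact stampCheck_eight_six_s4_10 c (hmemR c (by simp)) ⟨hlt2, pre3⟩ e (hmemR e (by simp)) ⟨hlt3, pre4⟩ hcovT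
    · exact stampCheck_eight_six_s4_11 c (hmemR c (by simp)) ⟨hlt2, pre3⟩ e (hmemR e (by simp)) ⟨hlt3, pre4⟩ hcovT
    · exact stampCheck_eight_six_s4_12 c (hmemR c (by simp)) ⟨hlt2, pre3⟩ e (hmemR e (by simp)) ⟨hlt3, pre4⟩ hcovT
    · exact stampCheck_eight_six_s4_13 c (hmemR c (by simp)) ⟨hlt2, pre3⟩ e (hmemR e (by simp)) ⟨hlt3, pre4⟩ hcovT
    · exact stampCheck_eight_six_s4_14 c (hmemR c (by simp)) ⟨hlt2, pre3⟩ e (hmemR e (by simp)) ⟨hlt3, pre4⟩ hcovT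
    · exact stampCheck_eight_six_s4_15 c (hmemR c (by simp)) ⟨hlt2, pre3⟩ e (hmemR e (by simp)) ⟨hlt3, pre4⟩ hcovT
    · exact stampCheck_eight_six_s4_16 c (hmemR c (by simp)) ⟨hlt2, pre3⟩ e (hmemR e (by simp)) ⟨hlt3, pre4⟩ hcovT
    · exact stampCheck_eight_six_s4_17 c (hmemR c (by simp)) ⟨hlt2, pre3⟩ e (hmemR e (by simp)) ⟨hlt3, pre4⟩ hcovT
    · exact stampCheck_eight_six_s4_18 c (hmemR c (by simp)) ⟨hlt2, pre3⟩ e (hmemR e (by simp)) ⟨hlt3, pre4⟩ hcovT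
    · exact stampCheck_eight_six_s4_19 c (hmemR c (by simp)) ⟨hlt2, pre3⟩ e (hmemR e (by simp)) ⟨hlt3, pre4⟩ hcovT
    · exact stampCheck_eight_six_s4_20 c (hmemR c (by simp)) ⟨hlt2, pre3⟩ e (hmemR e (by simp)) ⟨hlt3, pre4⟩ hcovT
    · exact stampCheck_eight_six_s4_21 c (hmemR c (by simp)) ⟨hlt2, pre3⟩ e (hmemR e (by simp)) ⟨hlt3, pre4⟩ hcovT
    · exact stampCheck_eight_six_s4_22 c (hmemR c (by simp)) ⟨hlt2, pre3⟩ e (hmemR e (by simp)) ⟨hlt3, pre4⟩ hcovT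
    · exact stampCheck_eight_six_s4_23 c (hmemR c (by simp)) ⟨hlt2, pre3⟩ e (hmemR e (by simp)) ⟨hlt3, pre4⟩ hcovT
    · exact stampCheck_eight_six_s4_24 c (hmemR c (by simp)) ⟨hlt2, pre3⟩ e (hmemR e (by simp)) ⟨hlt3, pre4⟩ hcovT
    · exact stampCheck_eight_six_s4_25 c (hmemR c (by simp)) ⟨hlt2, pre3⟩ e (hmemR e (by simp)) ⟨hlt3, pre4⟩ hcovT
    · exact stampCheck_eight_six_s4_26 c (hmemR c (by simp)) ⟨hlt2, pre3⟩ e (hmemR e (by simp)) ⟨hlt3, pre4⟩ hcovT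
    · exact stampCheck_eight_six_s4_27 c (hmemR c (by simp)) ⟨hlt2, pre3⟩ e (hmemR e (by simp)) ⟨hlt3, pre4⟩ hcovT
  · -- a = 5: the 8-fold sums of [0, 1, 5] cover [0, 28] and miss 29 ⇒ b ≤ 29
    have hbT : b ≤ 29 := by
      by_contra hh
      exact absurd (testBit_of_maskMod pre2 (show 29 < min 514 b by omega)) (by decide +kernel)
    interval_cases b
    · exact stampCheck_eight_six_s5_6 c (hmemR c (by simp)) ⟨hlt2, pre3⟩ e (hmemR e (by simp)) ⟨hlt3, pre4⟩ hcovT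
    · exact stampCheck_eight_six_s5_7 c (hmemR c (by simp)) ⟨hlt2, pre3⟩ e (hmemR e (by simp)) ⟨hlt3, pre4⟩ hcovT
    · exact stampCheck_eight_six_s5_8 c (hmemR c (by simp)) ⟨hlt2, pre3⟩ e (hmemR e (by simp)) ⟨hlt3, pre4⟩ hcovT
    · exact stampCheck_eight_six_s5_9 c (hmemR c (by simp)) ⟨hlt2, pre3⟩ e (hmemR e (by simp)) ⟨hlt3, pre4⟩ hcovT
    · exact stampCheck_eight_six_s5_10 c (hmemR c (by simp)) ⟨hlt2, pre3⟩ e (hmemR e (by simp)) ⟨hlt3, pre4⟩ hcovT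
    · exact stampCheck_eight_six_s5_11 c (hmemR c (by simp)) ⟨hlt2, pre3⟩ e (hmemR e (by simp)) ⟨hlt3, pre4⟩ hcovT
    · exact stampCheck_eight_six_s5_12 c (hmemR c (by simp)) ⟨hlt2, pre3⟩ e (hmemR e (by simp)) ⟨hlt3, pre4⟩ hcovT
    · exact stampCheck_eight_six_s5_13 c (hmemR c (by simp)) ⟨hlt2, pre3⟩ e (hmemR e (by simp)) ⟨hlt3, pre4⟩ hcovT
    · exact stampCheck_eight_six_s5_14 c (hmemR c (by simp)) ⟨hlt2, pre3⟩ e (hmemR e (by simp)) ⟨hlt3, pre4⟩ hcovT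
    · exact stampCheck_eight_six_s5_15 c (hmemR c (by simp)) ⟨hlt2, pre3⟩ e (hmemR e (by simp)) ⟨hlt3, pre4⟩ hcovT
    · exact stampCheck_eight_six_s5_16 c (hmemR c (by simp)) ⟨hlt2, pre3⟩ e (hmemR e (by simp)) ⟨hlt3, pre4⟩ hcovT
    · exact stampCheck_eight_six_s5_17 c (hmemR c (by simp)) ⟨hlt2, pre3⟩ e (hmemR e (by simp)) ⟨hlt3, pre4⟩ hcovT
    · exact stampCheck_eight_six_s5_18 c (hmemR c (by simp)) ⟨hlt2, pre3⟩ e (hmemR e (by simp)) ⟨hlt3, pre4⟩ hcovT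
    · exact stampCheck_eight_six_s5_19 c (hmemR c (by simp)) ⟨hlt2, pre3⟩ e (hmemR e (by simp)) ⟨hlt3, pre4⟩ hcovT
    · exact stampCheck_eight_six_s5_20 c (hmemR c (by simp)) ⟨hlt2, pre3⟩ e (hmemR e (by simp)) ⟨hlt3, pre4⟩ hcovT
    · exact stampCheck_eight_six_s5_21 c (hmemR c (by simp)) ⟨hlt2, pre3⟩ e (hmemR e (by simp)) ⟨hlt3, pre4⟩ hcovT
    · exact stampCheck_eight_six_s5_22 c (hmemR c (by simp)) ⟨hlt2, pre3⟩ e (hmemR e (by simp)) ⟨hlt3, pre4⟩ hcovT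
    · exact stampCheck_eight_six_s5_23 c (hmemR c (by simp)) ⟨hlt2, pre3⟩ e (hmemR e (by simp)) ⟨hlt3, pre4⟩ hcovT
    · exact stampCheck_eight_six_s5_24 c (hmemR c (by simp)) ⟨hlt2, pre3⟩ e (hmemR e (by simp)) ⟨hlt3, pre4⟩ hcovT
    · exact stampCheck_eight_six_s5_25 c (hmemR c (by simp)) ⟨hlt2, pre3⟩ e (hmemR e (by simp)) ⟨hlt3, pre4⟩ hcovT
    · exact stampCheck_eight_six_s5_26 c (hmemR c (by simp)) ⟨hlt2, pre3⟩ e (hmemR e (by simp)) ⟨hlt3, pre4⟩ hcovT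
    · exact stampCheck_eight_six_s5_27 c (hmemR c (by simp)) ⟨hlt2, pre3⟩ e (hmemR e (by simp)) ⟨hlt3, pre4⟩ hcovT
    · exact stampCheck_eight_six_s5_28 c (hmemR c (by simp)) ⟨hlt2, pre3⟩ e (hmemR e (by simp)) ⟨hlt3, pre4⟩ hcovT
    · exact stampCheck_eight_six_s5_29 c (hmemR c (by simp)) ⟨hlt2, pre3⟩ e (hmemR e (by simp)) ⟨hlt3, pre4⟩ hcovT
  · -- a = 6: the 8-fold sums of [0, 1, 6] cover [0, 28] and miss 29 ⇒ b ≤ 29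
    have hbT : b ≤ 29 := by
      by_contra hh
      exact absurd (testBit_of_maskMod pre2 (show 29 < min 514 b by omega)) (by decide +kernel)
    interval_cases b
    · exact stampCheck_eight_six_s6_7 c (hmemR c (by simp)) ⟨hlt2, pre3⟩ e (hmemR e (by simp)) ⟨hlt3, pre4⟩ hcovT
    · exact stampCheck_eight_six_s6_8 c (hmemR c (by simp)) ⟨hlt2, pre3⟩ e (hmemR e (by simp)) ⟨hlt3, pre4⟩ hcovT
    · exact stampCheck_eight_six_s6_9 c (hmemR c (by simp)) ⟨hlt2, pre3⟩ e (hmemR e (by simp)) ⟨hlt3, pre4⟩ hcovT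
    · exact stampCheck_eight_six_s6_10 c (hmemR c (by simp)) ⟨hlt2, pre3⟩ e (hmemR e (by simp)) ⟨hlt3, pre4⟩ hcovT
    · exact stampCheck_eight_six_s6_11 c (hmemR c (by simp)) ⟨hlt2, pre3⟩ e (hmemR e (by simp)) ⟨hlt3, pre4⟩ hcovT
    · exact stampCheck_eight_six_s6_12 c (hmemR c (by simp)) ⟨hlt2, pre3⟩ e (hmemR e (by simp)) ⟨hlt3, pre4⟩ hcovT
    · exact stampCheck_eight_six_s6_13 c (hmemR c (by simp)) ⟨hlt2, pre3⟩ e (hmemR e (by simp)) ⟨hlt3, pre4⟩ hcovT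
    · exact stampCheck_eight_six_s6_14 c (hmemR c (by simp)) ⟨hlt2, pre3⟩ e (hmemR e (by simp)) ⟨hlt3, pre4⟩ hcovT
    · exact stampCheck_eight_six_s6_15 c (hmemR c (by simp)) ⟨hlt2, pre3⟩ e (hmemR e (by simp)) ⟨hlt3, pre4⟩ hcovT
    · exact stampCheck_eight_six_s6_16 c (hmemR c (by simp)) ⟨hlt2, pre3⟩ e (hmemR e (by simp)) ⟨hlt3, pre4⟩ hcovT
    · exact stampCheck_eight_six_s6_17 c (hmemR c (by simp)) ⟨hlt2, pre3⟩ e (hmemR e (by simp)) ⟨hlt3, pre4⟩ hcovT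
    · exact stampCheck_eight_six_s6_18 c (hmemR c (by simp)) ⟨hlt2, pre3⟩ e (hmemR e (by simp)) ⟨hlt3, pre4⟩ hcovT
    · exact stampCheck_eight_six_s6_19 c (hmemR c (by simp)) ⟨hlt2, pre3⟩ e (hmemR e (by simp)) ⟨hlt3, pre4⟩ hcovT
    · exact stampCheck_eight_six_s6_20 c (hmemR c (by simp)) ⟨hlt2, pre3⟩ e (hmemR e (by simp)) ⟨hlt3, pre4⟩ hcovT
    · exact stampCheck_eight_six_s6_21 c (hmemR c (by simp)) ⟨hlt2, pre3⟩ e (hmemR e (by simp)) ⟨hlt3, pre4⟩ hcovT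
    · exact stampCheck_eight_six_s6_22 c (hmemR c (by simp)) ⟨hlt2, pre3⟩ e (hmemR e (by simp)) ⟨hlt3, pre4⟩ hcovT
    · exact stampCheck_eight_six_s6_23 c (hmemR c (by simp)) ⟨hlt2, pre3⟩ e (hmemR e (by simp)) ⟨hlt3, pre4⟩ hcovT
    · exact stampCheck_eight_six_s6_24 c (hmemR c (by simp)) ⟨hlt2, pre3⟩ e (hmemR e (by simp)) ⟨hlt3, pre4⟩ hcovT
    · exact stampCheck_eight_six_s6_25 c (hmemR c (by simp)) ⟨hlt2, pre3⟩ e (hmemR e (by simp)) ⟨hlt3, pre4⟩ hcovT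
    · exact stampCheck_eight_six_s6_26 c (hmemR c (by simp)) ⟨hlt2, pre3⟩ e (hmemR e (by simp)) ⟨hlt3, pre4⟩ hcovT
    · exact stampCheck_eight_six_s6_27 c (hmemR c (by simp)) ⟨hlt2, pre3⟩ e (hmemR e (by simp)) ⟨hlt3, pre4⟩ hcovT
    · exact stampCheck_eight_six_s6_28 c (hmemR c (by simp)) ⟨hlt2, pre3⟩ e (hmemR e (by simp)) ⟨hlt3, pre4⟩ hcovT
    · exact stampCheck_eight_six_s6_29 c (hmemR c (by simp)) ⟨hlt2, pre3⟩ e (hmemR e (by simp)) ⟨hlt3, pre4⟩ hcovT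
  · -- a = 7: the 8-fold sums of [0, 1, 7] cover [0, 26] and miss 27 ⇒ b ≤ 27
    have hbT : b ≤ 27 := by
      by_contra hh
      exact absurd (testBit_of_maskMod pre2 (show 27 < min 514 b by omega)) (by decide +kernel)
    interval_cases b
    · exact stampCheck_eight_six_s7_8 c (hmemR c (by simp)) ⟨hlt2, pre3⟩ e (hmemR e (by simp)) ⟨hlt3, pre4⟩ hcovT
    · exact stampCheck_eight_six_s7_9 c (hmemR c (by simp)) ⟨hlt2, pre3⟩ e (hmemR e (by simp)) ⟨hlt3, pre4⟩ hcovT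
    · exact stampCheck_eight_six_s7_10 c (hmemR c (by simp)) ⟨hlt2, pre3⟩ e (hmemR e (by simp)) ⟨hlt3, pre4⟩ hcovT
    · exact stampCheck_eight_six_s7_11 c (hmemR c (by simp)) ⟨hlt2, pre3⟩ e (hmemR e (by simp)) ⟨hlt3, pre4⟩ hcovT
    · exact stampCheck_eight_six_s7_12 c (hmemR c (by simp)) ⟨hlt2, pre3⟩ e (hmemR e (by simp)) ⟨hlt3, pre4⟩ hcovT
    · exact stampCheck_eight_six_s7_13 c (hmemR c (by simp)) ⟨hlt2, pre3⟩ e (hmemR e (by simp)) ⟨hlt3, pre4⟩ hcovT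
    · exact stampCheck_eight_six_s7_14 c (hmemR c (by simp)) ⟨hlt2, pre3⟩ e (hmemR e (by simp)) ⟨hlt3, pre4⟩ hcovT
    · exact stampCheck_eight_six_s7_15 c (hmemR c (by simp)) ⟨hlt2, pre3⟩ e (hmemR e (by simp)) ⟨hlt3, pre4⟩ hcovT
    · exact stampCheck_eight_six_s7_16 c (hmemR c (by simp)) ⟨hlt2, pre3⟩ e (hmemR e (by simp)) ⟨hlt3, pre4⟩ hcovT
    · exact stampCheck_eight_six_s7_17 c (hmemR c (by simp)) ⟨hlt2, pre3⟩ e (hmemR e (by simp)) ⟨hlt3, pre4⟩ hcovT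
    · exact stampCheck_eight_six_s7_18 c (hmemR c (by simp)) ⟨hlt2, pre3⟩ e (hmemR e (by simp)) ⟨hlt3, pre4⟩ hcovT
    · exact stampCheck_eight_six_s7_19 c (hmemR c (by simp)) ⟨hlt2, pre3⟩ e (hmemR e (by simp)) ⟨hlt3, pre4⟩ hcovT
    · exact stampCheck_eight_six_s7_20 c (hmemR c (by simp)) ⟨hlt2, pre3⟩ e (hmemR e (by simp)) ⟨hlt3, pre4⟩ hcovT
    · exact stampCheck_eight_six_s7_21 c (hmemR c (by simp)) ⟨hlt2, pre3⟩ e (hmemR e (by simp)) ⟨hlt3, pre4⟩ hcovT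
    · exact stampCheck_eight_six_s7_22 c (hmemR c (by simp)) ⟨hlt2, pre3⟩ e (hmemR e (by simp)) ⟨hlt3, pre4⟩ hcovT
    · exact stampCheck_eight_six_s7_23 c (hmemR c (by simp)) ⟨hlt2, pre3⟩ e (hmemR e (by simp)) ⟨hlt3, pre4⟩ hcovT
    · exact stampCheck_eight_six_s7_24 c (hmemR c (by simp)) ⟨hlt2, pre3⟩ e (hmemR e (by simp)) ⟨hlt3, pre4⟩ hcovT
    · exact stampCheck_eight_six_s7_25 c (hmemR c (by simp)) ⟨hlt2, pre3⟩ e (hmemR e (by simp)) ⟨hlt3, pre4⟩ hcovT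
    · exact stampCheck_eight_six_s7_26 c (hmemR c (by simp)) ⟨hlt2, pre3⟩ e (hmemR e (by simp)) ⟨hlt3, pre4⟩ hcovT
    · exact stampCheck_eight_six_s7_27 c (hmemR c (by simp)) ⟨hlt2, pre3⟩ e (hmemR e (by simp)) ⟨hlt3, pre4⟩ hcovT
  · -- a = 8: the 8-fold sums of [0, 1, 8] cover [0, 22] and miss 23 ⇒ b ≤ 23
    have hbT : b ≤ 23 := by
      by_contra hh
      exact absurd (testBit_of_maskMod pre2 (show 23 < min 514 b by omega)) (by decide +kernel)
    interval_cases b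
    · exact stampCheck_eight_six_s8_9 c (hmemR c (by simp)) ⟨hlt2, pre3⟩ e (hmemR e (by simp)) ⟨hlt3, pre4⟩ hcovT
    · exact stampCheck_eight_six_s8_10 c (hmemR c (by simp)) ⟨hlt2, pre3⟩ e (hmemR e (by simp)) ⟨hlt3, pre4⟩ hcovT
    · exact stampCheck_eight_six_s8_11 c (hmemR c (by simp)) ⟨hlt2, pre3⟩ e (hmemR e (by simp)) ⟨hlt3, pre4⟩ hcovT
    · exact stampCheck_eight_six_s8_12 c (hmemR c (by simp)) ⟨hlt2, pre3⟩ e (hmemR e (by simp)) ⟨hlt3, pre4⟩ hcovT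
    · exact stampCheck_eight_six_s8_13 c (hmemR c (by simp)) ⟨hlt2, pre3⟩ e (hmemR e (by simp)) ⟨hlt3, pre4⟩ hcovT
    · exact stampCheck_eight_six_s8_14 c (hmemR c (by simp)) ⟨hlt2, pre3⟩ e (hmemR e (by simp)) ⟨hlt3, pre4⟩ hcovT
    · exact stampCheck_eight_six_s8_15 c (hmemR c (by simp)) ⟨hlt2, pre3⟩ e (hmemR e (by simp)) ⟨hlt3, pre4⟩ hcovT
    · exact stampCheck_eight_six_s8_16 c (hmemR c (by simp)) ⟨hlt2, pre3⟩ e (hmemR e (by simp)) ⟨hlt3, pre4⟩ hcovT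
    · exact stampCheck_eight_six_s8_17 c (hmemR c (by simp)) ⟨hlt2, pre3⟩ e (hmemR e (by simp)) ⟨hlt3, pre4⟩ hcovT
    · exact stampCheck_eight_six_s8_18 c (hmemR c (by simp)) ⟨hlt2, pre3⟩ e (hmemR e (by simp)) ⟨hlt3, pre4⟩ hcovT
    · exact stampCheck_eight_six_s8_19 c (hmemR c (by simp)) ⟨hlt2, pre3⟩ e (hmemR e (by simp)) ⟨hlt3, pre4⟩ hcovT
    · exact stampCheck_eight_six_s8_20 c (hmemR c (by simp)) ⟨hlt2, pre3⟩ e (hmemR e (by simp)) ⟨hlt3, pre4⟩ hcovT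
    · exact stampCheck_eight_six_s8_21 c (hmemR c (by simp)) ⟨hlt2, pre3⟩ e (hmemR e (by simp)) ⟨hlt3, pre4⟩ hcovT
    · exact stampCheck_eight_six_s8_22 c (hmemR c (by simp)) ⟨hlt2, pre3⟩ e (hmemR e (by simp)) ⟨hlt3, pre4⟩ hcovT
    · exact stampCheck_eight_six_s8_23 c (hmemR c (by simp)) ⟨hlt2, pre3⟩ e (hmemR e (by simp)) ⟨hlt3, pre4⟩ hcovT
  · -- a = 9: the 8-fold sums of [0, 1, 9] cover [0, 16] and miss 17 ⇒ b ≤ 17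
    have hbT : b ≤ 17 := by
      by_contra hh
      exact absurd (testBit_of_maskMod pre2 (show 17 < min 514 b by omega)) (by decide +kernel)
    interval_cases b
    · exact stampCheck_eight_six_s9_10 c (hmemR c (by simp)) ⟨hlt2, pre3⟩ e (hmemR e (by simp)) ⟨hlt3, pre4⟩ hcovT
    · exact stampCheck_eight_six_s9_11 c (hmemR c (by simp)) ⟨hlt2, pre3⟩ e (hmemR e (by simp)) ⟨hlt3, pre4⟩ hcovT
    · exact stampCheck_eight_six_s9_12 c (hmemR c (by simp)) ⟨hlt2, pre3⟩ e (hmemR e (by simp)) ⟨hlt3, pre4⟩ hcovT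
    · exact stampCheck_eight_six_s9_13 c (hmemR c (by simp)) ⟨hlt2, pre3⟩ e (hmemR e (by simp)) ⟨hlt3, pre4⟩ hcovT
    · exact stampCheck_eight_six_s9_14 c (hmemR c (by simp)) ⟨hlt2, pre3⟩ e (hmemR e (by simp)) ⟨hlt3, pre4⟩ hcovT
    · exact stampCheck_eight_six_s9_15 c (hmemR c (by simp)) ⟨hlt2, pre3⟩ e (hmemR e (by simp)) ⟨hlt3, pre4⟩ hcovT
    · exact stampCheck_eight_six_s9_16 c (hmemR c (by simp)) ⟨hlt2, pre3⟩ e (hmemR e (by simp)) ⟨hlt3, pre4⟩ hcovT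
    · exact stampCheck_eight_six_s9_17 c (hmemR c (by simp)) ⟨hlt2, pre3⟩ e (hmemR e (by simp)) ⟨hlt3, pre4⟩ hcovT

end Summit.ValiantsHypothesis.ValiantsHypothesis.Theorems.LacunarySymmetroidMatrixDescartes.FiniteSector
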